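import Summits.ValiantsHypothesis.ValiantsHypothesis.Theorems.KPlusLogSqLawStaticPathExchange

/-!
# Route «KPlusLogSqLaw» — parametric max-weight independent set on a path: PARTICLES ARE WINDOW EXTREMA (the optimum's uncovered positions)

HONEST FRAMING.  Helper toward the crux `WeakLifting` (item `stmt-ValiantsHypothesis-19561`, route `KPlusLogSqLaw`, cell `pub-symmetroid`,
seat val-sym-lift-p4 g22, 2026-08-29) on the line of its witness-plan stub `stub_tridiagonalSectorB` (tropical twin of the STATIC tridiagonal
sector = parametric maximum-weight independent set on a path).  Sequel of `…StaticPathExchange` (the exchange form of the event test).  For an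
independent subset `M` of the block `i+1, …, i+n` with prefix-sum lines `S_0, …, S_n` call a position `x ≤ n` UNCOVERED («a particle») if
`i+x ∉ M` and `i+x+1 ∉ M`.  Here (memo `HOME/val-sym-lift-p4/PARTICLES.md` §1.2, the located Lemmas 1–2 of FAN.md now in the kernel):
* `indep_symmDiff_Ioc_iff` — TOGGLE FEASIBILITY: for independent `M` and `a < b`, the toggled set `M ∆ {a+1, …, b}` is independent iff `a ∉ M`, `b+1 ∉ M`
  and no two consecutive items strictly inside the stretch are both absent (no dimer sticks out of the stretch, no uncovered position strictly inside);
* `mem_iff_odd_of_uncovered_right` / `mem_iff_even_of_uncovered_left` — an uncovered end and a covered interior force the alternating pattern of `M` on the stretch;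
* `sum_symmDiff_sub_eq_sign` — the weight of the toggled set minus the weight of `M` is `(-1)^α (S_κ - S_α)` if `i+α+1 ∈ M` and `-(-1)^α (S_κ - S_α)` otherwise;
* **`sign_law_of_opt`** — hence if `M` is OPTIMAL at `θ` (not necessarily unique) and the toggle is feasible, that signed quantity is `≤ 0`;
* corollaries = the optimality structure of the particle set: **`L_le_of_uncovered_even`** (an uncovered EVEN position carries the LOWEST even line among
  the positions not separated from it by an uncovered position — the even particle is the minimum of its window), **`L_ge_of_uncovered_odd`** (odd particles
  are window maxima), **`L_le_of_consecutive_uncovered`** (two consecutive particles are INVERTED: the even line below the odd line),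
  **`sign_of_covered_aligned`** (HALF-SEPARATION inside a gap: across a dimer-aligned covered stretch the even end line is above the odd end line),
  `exists_uncovered_between_of_lt_even/odd` (SCREENING: a line strictly beyond a particle's line on the particle's side is separated from it by a particle).
Statements about a path DP; nothing here asserts anything about `WeakLifting`, `TropicalB`, `KPlusLogSqLaw`, the stub in its window, `MatrixDescartes`
(stmt-ValiantsHypothesis-18050) or `VP ≠ VNP`; the ORDER QUESTION stays open.
-/

set_option linter.dupNamespace false
set_option autoImplicit false

namespace Summit.ValiantsHypothesis.ValiantsHypothesis.Theorems.KPlusLogSqLaw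

open Finset Classical
open scoped symmDiff

namespace StaticPathFold

noncomputable section

/-! ## 1. Toggle feasibility and the forced pattern -/

section Pattern

/-- **TOGGLE FEASIBILITY.**  For an independent item set `M` (no two consecutive items) and `a < b`, the toggled set `M ∆ {a+1, …, b}` is independent
iff `a ∉ M` (no dimer enters the stretch from the left), `b + 1 ∉ M` (none from the right) and for every `a < t < b` one of `t`, `t+1` lies in `M`
(no uncovered position strictly inside). [folklore] -/
theorem indep_symmDiff_Ioc_iff {M : Finset ℕ} (hM : Indep M) {a b : ℕ} (hab : a < b) :
    Indep (M ∆ Ioc a b) ↔ (a ∉ M ∧ b + 1 ∉ M ∧ ∀ t, a < t → t < b → (t ∈ M ∨ t + 1 ∈ M)) := by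
  constructor
  · intro hT
    refine ⟨fun ha => ?_, fun hb => ?_, fun t hat htb => ?_⟩
    · have ha1 : a + 1 ∉ M := hM a ha
      have haT : a ∈ M ∆ Ioc a b := Finset.mem_symmDiff.mpr (Or.inl ⟨ha, fun h => by have := mem_Ioc.mp h; omega⟩)
      exact hT a haT (Finset.mem_symmDiff.mpr (Or.inr ⟨mem_Ioc.mpr ⟨by omega, by omega⟩, ha1⟩))
    · have hbM : b ∉ M := fun h => hM b h hb
      have hbT : b ∈ M ∆ Ioc a b := Finset.mem_symmDiff.mpr (Or.inr ⟨mem_Ioc.mpr ⟨hab, le_rfl⟩, hbM⟩)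
      exact hT b hbT (Finset.mem_symmDiff.mpr (Or.inl ⟨hb, fun h => by have := mem_Ioc.mp h; omega⟩))
    · by_contra h
      push Not at h
      have htT : t ∈ M ∆ Ioc a b := Finset.mem_symmDiff.mpr (Or.inr ⟨mem_Ioc.mpr ⟨hat, htb.le⟩, h.1⟩)
      exact hT t htT (Finset.mem_symmDiff.mpr (Or.inr ⟨mem_Ioc.mpr ⟨by omega, by omega⟩, h.2⟩))
  · rintro ⟨ha, hb, hin⟩ t ht ht1
    rw [Finset.mem_symmDiff, mem_Ioc] at ht ht1
    rcases ht with ⟨htM, htI⟩ | ⟨htI, htM⟩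
    · rcases ht1 with ⟨h1M, _⟩ | ⟨h1I, _⟩
      · exact hM t htM h1M
      · -- `t ∉ stretch`, `t+1 ∈ stretch`: `t = a`
        have : t = a := by omega
        subst this; exact ha htM
    · rcases ht1 with ⟨h1M, h1I⟩ | ⟨h1I, h1M⟩
      · -- `t ∈ stretch`, `t+1 ∉ stretch`: `t = b`
        have : t = b := by omega
        subst this; exact hb h1M
      · rcases hin t htI.1 (by omega) with h | h
        · exact htM h
        · exact h1M h

/-- **pattern forced from an uncovered RIGHT end**: if position `κ` is uncovered and every position strictly between `α` and `κ` is covered, then on the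
stretch `i+α < t ≤ i+κ` membership in `M` is «`i + κ - t` odd» (`i+κ ∉ M`, `i+κ-1 ∈ M`, `i+κ-2 ∉ M`, …). [folklore] -/
theorem mem_iff_odd_of_uncovered_right {M : Finset ℕ} (hM : Indep M) {i α κ : ℕ}
    (hκ : i + κ ∉ M ∧ i + κ + 1 ∉ M) (hcov : ∀ x, α < x → x < κ → ¬ (i + x ∉ M ∧ i + x + 1 ∉ M)) :
    ∀ d t, t + d = i + κ → i + α < t → (t ∈ M ↔ Odd d) := by
  intro d
  induction d with
  | zero =>
    intro t ht _
    have : t = i + κ := by omega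
    subst this
    exact ⟨fun h => absurd h hκ.1, fun h => absurd h (by norm_num)⟩
  | succ d ih =>
    intro t ht hat
    have ih' := ih (t + 1) (by omega) (by omega)
    rcases Nat.even_or_odd d with hd | hd
    · -- `t + 1 ∉ M`, and position `t - i` is covered, so `t ∈ M`
      have h1 : t + 1 ∉ M := fun h => (Nat.not_odd_iff_even.mpr hd) (ih'.mp h)
      have hc := hcov (t - i) (by omega) (by omega)
      rw [show i + (t - i) = t by omega] at hc
      have ht : t ∈ M := by by_contra h; exact hc ⟨h, h1⟩
      exact ⟨fun _ => hd.add_one, fun _ => ht⟩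
    · have h1 : t + 1 ∈ M := ih'.mpr hd
      have ht : t ∉ M := fun h => hM t h h1
      exact ⟨fun h => absurd h ht, fun h => absurd h (Nat.not_odd_iff_even.mpr hd.add_one)⟩

/-- **pattern forced from an uncovered LEFT end**: if position `α` is uncovered and every position strictly between `α` and `κ` is covered, then on the
stretch `t = i+α+1+d ≤ i+κ` membership in `M` is «`d` odd» (`i+α+1 ∉ M`, `i+α+2 ∈ M`, …). [folklore] -/
theorem mem_iff_even_of_uncovered_left {M : Finset ℕ} (hM : Indep M) {i α κ : ℕ}
    (hα : i + α ∉ M ∧ i + α + 1 ∉ M) (hcov : ∀ x, α < x → x < κ → ¬ (i + x ∉ M ∧ i + x + 1 ∉ M)) :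
    ∀ d t, t = i + α + 1 + d → t ≤ i + κ → (t ∈ M ↔ Odd d) := by
  intro d
  induction d with
  | zero =>
    intro t ht _
    subst ht
    exact ⟨fun h => absurd h hα.2, fun h => absurd h (by norm_num)⟩
  | succ d ih =>
    intro t ht htκ
    have ih' := ih (t - 1) (by omega) (by omega)
    rcases Nat.even_or_odd d with hd | hd
    · have h1 : t - 1 ∉ M := fun h => (Nat.not_odd_iff_even.mpr hd) (ih'.mp h)
      have hc := hcov (t - 1 - i) (by omega) (by omega)
      rw [show i + (t - 1 - i) = t - 1 by omega, show t - 1 + 1 = t by omega] at hc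
      have ht' : t ∈ M := by by_contra h; exact hc ⟨h1, h⟩
      exact ⟨fun _ => hd.add_one, fun _ => ht'⟩
    · have h1 : t - 1 ∈ M := ih'.mpr hd
      have ht' : t ∉ M := fun h => hM (t - 1) h1 (by rw [show t - 1 + 1 = t by omega]; exact h)
      exact ⟨fun h => absurd h ht', fun h => absurd h (Nat.not_odd_iff_even.mpr hd.add_one)⟩

end Pattern

/-! ## 2. The signed weight change of a feasible toggle and the sign law at an optimum -/

section Sign

variable (w₁ w₀ : ℕ → ℝ)

/-- **the toggle changes the weight by `(-1)^α (S_κ - S_α)` if `i+α+1 ∈ M`, by `-(-1)^α (S_κ - S_α)` otherwise** (both `M` and the toggled set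
independent, `α < κ`). [folklore] -/
theorem sum_symmDiff_sub_eq_sign {M : Finset ℕ} {i α κ : ℕ} (hακ : α < κ) (hM : Indep M)
    (hT : Indep (M ∆ Ioc (i + α) (i + κ))) (τ : ℝ) :
    ∑ t ∈ M ∆ Ioc (i + α) (i + κ), W w₁ w₀ t τ - ∑ t ∈ M, W w₁ w₀ t τ =
      (if i + α + 1 ∈ M then ((-1 : ℝ) ^ α) else -((-1 : ℝ) ^ α)) *
        (L (altA (shift i w₁)) (altB (shift i w₀)) κ τ - L (altA (shift i w₁)) (altB (shift i w₀)) α τ) := by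
  set ε : ℕ → ℝ := fun t => if t ∈ M then -1 else 1 with hε
  set s : ℝ := (if i + α + 1 ∈ M then ((-1 : ℝ) ^ α) else -((-1 : ℝ) ^ α)) with hs
  have hpat : ∀ t, i + α + 1 ≤ t → t ≤ i + κ → ε t = s * (-1) ^ (t - i) := by
    intro t ht
    induction t, ht using Nat.le_induction with
    | base =>
      intro _
      have hαα : ((-1 : ℝ) ^ α) * ((-1 : ℝ) ^ α) = 1 := by rw [← pow_add, ← two_mul, pow_mul]; norm_num
      rw [show i + α + 1 - i = α + 1 by omega, pow_succ]
      by_cases hm : i + α + 1 ∈ M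
      · simp only [hε, hs, hm, if_true]; linear_combination hαα
      · simp only [hε, hs, hm, if_false]; linear_combination -hαα
    | succ t ht ih =>
      intro htκ
      have ih' := ih (by omega)
      have halt : (t + 1 ∈ M ↔ t ∉ M) := mem_succ_iff_not_mem_of_indep hM hT (by omega) htκ
      rw [show t + 1 - i = (t - i) + 1 by omega, pow_succ]
      by_cases h0 : t ∈ M
      · have h1 : t + 1 ∉ M := fun h1 => (halt.mp h1) h0
        have e0 : ε t = -1 := by simp [hε, h0]
        have e1 : ε (t + 1) = 1 := by simp [hε, h1]
        rw [e0] at ih'; rw [e1]; linear_combination -ih'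
      · have h1 : t + 1 ∈ M := halt.mpr h0
        have e0 : ε t = 1 := by simp [hε, h0]
        have e1 : ε (t + 1) = -1 := by simp [hε, h1]
        rw [e0] at ih'; rw [e1]; linear_combination -ih'
  rw [sum_symmDiff_sub, sub_L_alt_eq_sum w₁ w₀ i α τ κ hακ.le, mul_sum]
  refine sum_congr rfl fun t ht => ?_
  have htb := mem_Ioc.mp ht
  have hε' : (if t ∈ M then -W w₁ w₀ t τ else W w₁ w₀ t τ) = ε t * W w₁ w₀ t τ := by
    by_cases h : t ∈ M <;> simp [hε, h]
  rw [hε', hpat t (by omega) htb.2]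
  ring

/-- **SIGN LAW AT AN OPTIMUM.**  If `M` is an optimal (not necessarily unique) independent subset of the block `i+1, …, i+n` at `θ` and the toggle of the
stretch `α+1, …, κ` (`α < κ ≤ n`) is feasible, then `(S_κ - S_α)(θ)` has the sign `-(-1)^α` if `i+α+1 ∈ M` and `(-1)^α` otherwise (weakly). [folklore] -/
theorem sign_law_of_opt {i n α κ : ℕ} {θ : ℝ} {M : Finset ℕ} (hακ : α < κ) (hκn : κ ≤ n) (hM : M ∈ indepSets i n)
    (hopt : ∀ T ∈ indepSets i n, ∑ t ∈ T, W w₁ w₀ t θ ≤ ∑ t ∈ M, W w₁ w₀ t θ)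
    (hT : Indep (M ∆ Ioc (i + α) (i + κ))) :
    (if i + α + 1 ∈ M then ((-1 : ℝ) ^ α) else -((-1 : ℝ) ^ α)) *
        (L (altA (shift i w₁)) (altB (shift i w₀)) κ θ - L (altA (shift i w₁)) (altB (shift i w₀)) α θ) ≤ 0 := by
  rcases mem_indepSets.mp hM with ⟨hM1, hM2⟩
  have hTmem : M ∆ Ioc (i + α) (i + κ) ∈ indepSets i n := by
    refine mem_indepSets.mpr ⟨fun t ht => ?_, hT⟩
    rw [Finset.mem_symmDiff] at ht
    rcases ht with ⟨htM, _⟩ | ⟨htI, _⟩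
    · exact hM1 htM
    · have := mem_Ioc.mp htI; exact mem_Ioc.mpr ⟨by omega, by omega⟩
  rw [← sum_symmDiff_sub_eq_sign w₁ w₀ hακ hM2 hT θ]
  linarith [hopt _ hTmem]

end Sign

/-! ## 3. The optimality structure of the particle set -/

section Particles

variable (w₁ w₀ : ℕ → ℝ)

/-- **EVEN PARTICLES ARE WINDOW MINIMA.**  At an optimum `M`: if the even position `v` is uncovered and `u ≠ v` is an even position with no uncovered
position strictly between `u` and `v`, then `S_v(θ) ≤ S_u(θ)`. [folklore] -/
theorem L_le_of_uncovered_even {i n u v : ℕ} {θ : ℝ} {M : Finset ℕ} (hM : M ∈ indepSets i n)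
    (hopt : ∀ T ∈ indepSets i n, ∑ t ∈ T, W w₁ w₀ t θ ≤ ∑ t ∈ M, W w₁ w₀ t θ)
    (hun : u ≤ n) (hvn : v ≤ n) (hu : Even u) (hv : Even v) (huv : u ≠ v)
    (hunc : i + v ∉ M ∧ i + v + 1 ∉ M)
    (hcov : ∀ x, min u v < x → x < max u v → ¬ (i + x ∉ M ∧ i + x + 1 ∉ M)) :
    L (altA (shift i w₁)) (altB (shift i w₀)) v θ ≤ L (altA (shift i w₁)) (altB (shift i w₀)) u θ := by
  rcases mem_indepSets.mp hM with ⟨_, hM2⟩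
  have hu' := hu; have hv' := hv
  rw [Nat.even_iff] at hu' hv'
  rcases Nat.lt_or_gt_of_ne huv with h | h
  · -- `u < v`: the right end is uncovered
    have hcov' : ∀ x, u < x → x < v → ¬ (i + x ∉ M ∧ i + x + 1 ∉ M) := fun x h1 h2 =>
      hcov x (by rw [min_eq_left h.le]; exact h1) (by rw [max_eq_right h.le]; exact h2)
    have hpat := mem_iff_odd_of_uncovered_right hM2 hunc hcov'
    have h1 : i + u + 1 ∈ M := (hpat (v - u - 1) (i + u + 1) (by omega) (by omega)).mpr (by rw [Nat.odd_iff]; omega)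
    have h0 : i + u ∉ M := fun h0 => hM2 _ h0 h1
    have hT : Indep (M ∆ Ioc (i + u) (i + v)) :=
      (indep_symmDiff_Ioc_iff hM2 (by omega)).mpr ⟨h0, hunc.2, fun t h1 h2 => by
        have hc := hcov' (t - i) (by omega) (by omega)
        rw [show i + (t - i) = t by omega] at hc; tauto⟩
    have hs := sign_law_of_opt w₁ w₀ h hvn hM hopt hT
    rw [if_pos h1, Even.neg_one_pow hu, one_mul] at hs
    linarith
  · -- `v < u`: the left end is uncovered
    have hcov' : ∀ x, v < x → x < u → ¬ (i + x ∉ M ∧ i + x + 1 ∉ M) := fun x h1 h2 =>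
      hcov x (by rw [min_eq_right h.le]; exact h1) (by rw [max_eq_left h.le]; exact h2)
    have hpat := mem_iff_even_of_uncovered_left hM2 hunc hcov'
    have h1 : i + u ∈ M := (hpat (u - v - 1) (i + u) (by omega) le_rfl).mpr (by rw [Nat.odd_iff]; omega)
    have h0 : i + u + 1 ∉ M := hM2 _ h1
    have hT : Indep (M ∆ Ioc (i + v) (i + u)) :=
      (indep_symmDiff_Ioc_iff hM2 (by omega)).mpr ⟨hunc.1, h0, fun t h1 h2 => by
        have hc := hcov' (t - i) (by omega) (by omega)
        rw [show i + (t - i) = t by omega] at hc; tauto⟩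
    have hs := sign_law_of_opt w₁ w₀ h hun hM hopt hT
    rw [if_neg hunc.2, Even.neg_one_pow hv] at hs
    linarith

/-- **ODD PARTICLES ARE WINDOW MAXIMA.**  At an optimum `M`: if the odd position `v` is uncovered and `u ≠ v` is an odd position with no uncovered
position strictly between, then `S_u(θ) ≤ S_v(θ)`. [folklore] -/
theorem L_ge_of_uncovered_odd {i n u v : ℕ} {θ : ℝ} {M : Finset ℕ} (hM : M ∈ indepSets i n)
    (hopt : ∀ T ∈ indepSets i n, ∑ t ∈ T, W w₁ w₀ t θ ≤ ∑ t ∈ M, W w₁ w₀ t θ)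
    (hun : u ≤ n) (hvn : v ≤ n) (hu : Odd u) (hv : Odd v) (huv : u ≠ v)
    (hunc : i + v ∉ M ∧ i + v + 1 ∉ M)
    (hcov : ∀ x, min u v < x → x < max u v → ¬ (i + x ∉ M ∧ i + x + 1 ∉ M)) :
    L (altA (shift i w₁)) (altB (shift i w₀)) u θ ≤ L (altA (shift i w₁)) (altB (shift i w₀)) v θ := by
  rcases mem_indepSets.mp hM with ⟨_, hM2⟩
  have hu' := hu; have hv' := hv
  rw [Nat.odd_iff] at hu' hv'
  rcases Nat.lt_or_gt_of_ne huv with h | h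
  · have hcov' : ∀ x, u < x → x < v → ¬ (i + x ∉ M ∧ i + x + 1 ∉ M) := fun x h1 h2 =>
      hcov x (by rw [min_eq_left h.le]; exact h1) (by rw [max_eq_right h.le]; exact h2)
    have hpat := mem_iff_odd_of_uncovered_right hM2 hunc hcov'
    have h1 : i + u + 1 ∈ M := (hpat (v - u - 1) (i + u + 1) (by omega) (by omega)).mpr (by rw [Nat.odd_iff]; omega)
    have h0 : i + u ∉ M := fun h0 => hM2 _ h0 h1
    have hT : Indep (M ∆ Ioc (i + u) (i + v)) :=
      (indep_symmDiff_Ioc_iff hM2 (by omega)).mpr ⟨h0, hunc.2, fun t h1 h2 => by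
        have hc := hcov' (t - i) (by omega) (by omega)
        rw [show i + (t - i) = t by omega] at hc; tauto⟩
    have hs := sign_law_of_opt w₁ w₀ h hvn hM hopt hT
    rw [if_pos h1, Odd.neg_one_pow hu] at hs
    linarith
  · have hcov' : ∀ x, v < x → x < u → ¬ (i + x ∉ M ∧ i + x + 1 ∉ M) := fun x h1 h2 =>
      hcov x (by rw [min_eq_right h.le]; exact h1) (by rw [max_eq_left h.le]; exact h2)
    have hpat := mem_iff_even_of_uncovered_left hM2 hunc hcov'
    have h1 : i + u ∈ M := (hpat (u - v - 1) (i + u) (by omega) le_rfl).mpr (by rw [Nat.odd_iff]; omega)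
    have h0 : i + u + 1 ∉ M := hM2 _ h1
    have hT : Indep (M ∆ Ioc (i + v) (i + u)) :=
      (indep_symmDiff_Ioc_iff hM2 (by omega)).mpr ⟨hunc.1, h0, fun t h1 h2 => by
        have hc := hcov' (t - i) (by omega) (by omega)
        rw [show i + (t - i) = t by omega] at hc; tauto⟩
    have hs := sign_law_of_opt w₁ w₀ h hun hM hopt hT
    rw [if_neg hunc.2, Odd.neg_one_pow hv] at hs
    linarith

/-- **CONSECUTIVE PARTICLES ARE INVERTED.**  At an optimum `M`: if the positions `e` (even) and `o` (odd) are both uncovered and no position strictly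
between them is uncovered, then `S_e(θ) ≤ S_o(θ)` — the ceiling line lies BELOW the floor line. [folklore] -/
theorem L_le_of_consecutive_uncovered {i n e o : ℕ} {θ : ℝ} {M : Finset ℕ} (hM : M ∈ indepSets i n)
    (hopt : ∀ T ∈ indepSets i n, ∑ t ∈ T, W w₁ w₀ t θ ≤ ∑ t ∈ M, W w₁ w₀ t θ)
    (hen : e ≤ n) (hon : o ≤ n) (he : Even e) (ho : Odd o)
    (hue : i + e ∉ M ∧ i + e + 1 ∉ M) (huo : i + o ∉ M ∧ i + o + 1 ∉ M)
    (hcov : ∀ x, min e o < x → x < max e o → ¬ (i + x ∉ M ∧ i + x + 1 ∉ M)) :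
    L (altA (shift i w₁)) (altB (shift i w₀)) e θ ≤ L (altA (shift i w₁)) (altB (shift i w₀)) o θ := by
  rcases mem_indepSets.mp hM with ⟨_, hM2⟩
  have heo : e ≠ o := fun h => by rw [h] at he; exact (Nat.not_even_iff_odd.mpr ho) he
  rcases Nat.lt_or_gt_of_ne heo with h | h
  · have hT : Indep (M ∆ Ioc (i + e) (i + o)) :=
      (indep_symmDiff_Ioc_iff hM2 (by omega)).mpr ⟨hue.1, huo.2, fun t h1 h2 => by
        have hc := hcov (t - i) (by rw [min_eq_left h.le]; omega) (by rw [max_eq_right h.le]; omega)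
        rw [show i + (t - i) = t by omega] at hc; tauto⟩
    have hs := sign_law_of_opt w₁ w₀ h hon hM hopt hT
    rw [if_neg hue.2, Even.neg_one_pow he] at hs
    linarith
  · have hT : Indep (M ∆ Ioc (i + o) (i + e)) :=
      (indep_symmDiff_Ioc_iff hM2 (by omega)).mpr ⟨huo.1, hue.2, fun t h1 h2 => by
        have hc := hcov (t - i) (by rw [min_eq_right h.le]; omega) (by rw [max_eq_left h.le]; omega)
        rw [show i + (t - i) = t by omega] at hc; tauto⟩
    have hs := sign_law_of_opt w₁ w₀ h hen hM hopt hT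
    rw [if_neg huo.2, Odd.neg_one_pow ho] at hs
    linarith

/-- **HALF-SEPARATION INSIDE A GAP.**  At an optimum `M`: if the stretch of positions `α < κ` is covered inward at both ends (`i+α+1 ∈ M`, i.e. the dimer
at `α` points into the stretch, and `i+κ+1 ∉ M`) with no uncovered position strictly inside, then `(-1)^α (S_κ - S_α)(θ) ≤ 0`: an even `α` lies ABOVE the
later odd `κ`, an odd `α` BELOW the later even `κ` (the CREATION exchange is not improving). [folklore] -/
theorem sign_of_covered_aligned {i n α κ : ℕ} {θ : ℝ} {M : Finset ℕ} (hακ : α < κ) (hκn : κ ≤ n) (hM : M ∈ indepSets i n)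
    (hopt : ∀ T ∈ indepSets i n, ∑ t ∈ T, W w₁ w₀ t θ ≤ ∑ t ∈ M, W w₁ w₀ t θ)
    (hα : i + α + 1 ∈ M) (hκ : i + κ + 1 ∉ M)
    (hcov : ∀ x, α < x → x < κ → ¬ (i + x ∉ M ∧ i + x + 1 ∉ M)) :
    ((-1 : ℝ) ^ α) * (L (altA (shift i w₁)) (altB (shift i w₀)) κ θ - L (altA (shift i w₁)) (altB (shift i w₀)) α θ) ≤ 0 := by
  rcases mem_indepSets.mp hM with ⟨_, hM2⟩
  have h0 : i + α ∉ M := fun h0 => hM2 _ h0 hα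
  have hT : Indep (M ∆ Ioc (i + α) (i + κ)) :=
    (indep_symmDiff_Ioc_iff hM2 (by omega)).mpr ⟨h0, hκ, fun t h1 h2 => by
      have hc := hcov (t - i) (by omega) (by omega)
      rw [show i + (t - i) = t by omega] at hc; tauto⟩
  have hs := sign_law_of_opt w₁ w₀ hακ hκn hM hopt hT
  rwa [if_pos hα] at hs

/-- **SCREENING (the nesting lemma's static core).**  At an optimum `M`: an even line that lies strictly BELOW an uncovered even position's line is separated
from it by an uncovered position — if `v` is an uncovered even position and `S_u(θ) < S_v(θ)` for an even position `u`, some position strictly between `u`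
and `v` is uncovered.  [Hence successive undercutters of a line from one side approach it: PARTICLES.md §3.3.] [folklore] -/
theorem exists_uncovered_between_of_lt_even {i n u v : ℕ} {θ : ℝ} {M : Finset ℕ} (hM : M ∈ indepSets i n)
    (hopt : ∀ T ∈ indepSets i n, ∑ t ∈ T, W w₁ w₀ t θ ≤ ∑ t ∈ M, W w₁ w₀ t θ)
    (hun : u ≤ n) (hvn : v ≤ n) (hu : Even u) (hv : Even v)
    (hunc : i + v ∉ M ∧ i + v + 1 ∉ M)
    (hlt : L (altA (shift i w₁)) (altB (shift i w₀)) u θ < L (altA (shift i w₁)) (altB (shift i w₀)) v θ) :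
    ∃ x, min u v < x ∧ x < max u v ∧ (i + x ∉ M ∧ i + x + 1 ∉ M) := by
  by_contra h
  push Not at h
  have huv : u ≠ v := fun e => by rw [e] at hlt; exact lt_irrefl _ hlt
  have := L_le_of_uncovered_even w₁ w₀ hM hopt hun hvn hu hv huv hunc (fun x h1 h2 hx => hx.2 (h x h1 h2 hx.1))
  linarith

/-- **SCREENING, odd version**: if `v` is an uncovered odd position and `S_v(θ) < S_u(θ)` for an odd position `u`, some position strictly between `u` and
`v` is uncovered. [folklore] -/
theorem exists_uncovered_between_of_lt_odd {i n u v : ℕ} {θ : ℝ} {M : Finset ℕ} (hM : M ∈ indepSets i n)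
    (hopt : ∀ T ∈ indepSets i n, ∑ t ∈ T, W w₁ w₀ t θ ≤ ∑ t ∈ M, W w₁ w₀ t θ)
    (hun : u ≤ n) (hvn : v ≤ n) (hu : Odd u) (hv : Odd v)
    (hunc : i + v ∉ M ∧ i + v + 1 ∉ M)
    (hlt : L (altA (shift i w₁)) (altB (shift i w₀)) v θ < L (altA (shift i w₁)) (altB (shift i w₀)) u θ) :
    ∃ x, min u v < x ∧ x < max u v ∧ (i + x ∉ M ∧ i + x + 1 ∉ M) := by
  by_contra h
  push Not at h
  have huv : u ≠ v := fun e => by rw [e] at hlt; exact lt_irrefl _ hlt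
  have := L_ge_of_uncovered_odd w₁ w₀ hM hopt hun hvn hu hv huv hunc (fun x h1 h2 hx => hx.2 (h x h1 h2 hx.1))
  linarith

end Particles

end

end StaticPathFold

end Summit.ValiantsHypothesis.ValiantsHypothesis.Theorems.KPlusLogSqLaw
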